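import Mathlib.RingTheory.PiTensorProduct
import Mathlib.RingTheory.TensorProduct.Basic
import Mathlib.FieldTheory.IntermediateField.Basic
import Mathlib.FieldTheory.IsAlgClosed.AlgebraicClosure
import Mathlib.Algebra.Order.Archimedean.Real.Basic
import Mathlib.Order.ConditionallyCompleteLattice.Basic
import Summits.ABC.IUTFork.Thm311Sig
import HarnessLib

/-!
# K. Joshi, *Arithmetic Teichmüller spaces III* (arXiv:2401.13508v4) §7.8: the theta-values loci in
# `B̆_p ⊗_{B_p} ⋯ ⊗_{B_p} B̆_p` and in `B̆_p` — multiplication of lifts of theta-values, Lemma 7.8.1.2, Thm. 7.8.3.1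

Block E of the abc-iut cell (rung LADDER-ABC:A2.E; seat abc-iut-E-t15, slot T-15 of `plan/E/ASSIGNMENTS.md`;
inventory `plan/E/t15/INVENTORY.tsv`; sequel `Joshi/ThetaLociModuli.lean` = §7.9). TYPING ONLY: the OBJECTS of
[J-III] = K. Joshi, arXiv:2401.13508v4 ("Preliminary version for comments", unrefereed; bib `Joshi2024ATS3`) §7.8
(PDF p.67 l.48 – p.70 l.10) as Lean structures/definitions over abstract carriers, and the statements printed
there as `Prop`-valued definitions tagged `@[claim "Joshi2024ATS3" "disputed"]` — never an axiom, instance,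
`sorry` or Literature fact; what follows from the typed signature alone is a proved `theorem`. No side is taken
on [IUTchIII] Cor. 3.12, on Joshi's claims, or on Mochizuki's reports on them (`Mochizuki2024JoshiReport`);
typed ≠ proved ≠ endorsed. Locators «p.N l.M» = line M of PDF page N of the cell's render
`lit/renders/Joshi-arxiv-2401.13508/pNNNN.txt` (printed page = PDF page − 1).

CONTENT (each declaration below quotes its sentence): §7.8.1 the multiplication `B̆_p^{ℓ*} → B̆_p` and its
factorisation (7.8.1.1) through `B̆_p ⊗_{B_p} ⋯ ⊗_{B_p} B̆_p`; Lemma 7.8.1.2 (that tensor power "`= B_p ⊗_{ℚ_p} (⊕_α E″_α)`");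
§7.8.2 the loci `Θ̂_{Joshi,p}` (image in the tensor power) and `Θ̂̂_{Joshi,p} ⊂ B̆_p` (image under multiplication);
Thm. 7.8.3.1 the adelic loci `Θ̂^{B̆}_Joshi = Π_p Θ̂_{Joshi,p}`, `Θ̂̂^{B̆}_Joshi ⊂ Π_p B̆_p` ("except for `B_p` factor on the
right, the locus in [IUTchIII, Corollary 3.12] is of this type"; "lower bounds … given by Theorem 7.7.3.1");
Rmk. 7.8.3.2 `sup{|z|_{B̆} : z ∈ Θ̂} ≥ sup{|z|_{B̆} : z ∈ Θ̂̂}`.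

DESIGN (interim carrier rule, plan/E/ASSIGNMENTS.md §0.3). Self-contained over UNBUNDLED carriers: a field `K`
(= `ℚ_p`), a commutative `K`-algebra `B` (= `B_p = B_{ℂ_p^♭,ℚ_p}`, §5; merge-debt «J3:§5 = E-t9»), a commutative
`B`-algebra `A` (= the bundling ring `B̆_p`; merge-debt «J3:§7.5/§7.7 = E-t13»), a type `W` (= `V^{odd,ss}_p`), a
finite type `J` (= labels `1, …, ℓ*`). `BundlingDatum` packages the presentation (7.8.1.3)/Lem. 7.5.2.3 `B̆_p ≅
B_p ⊗_{ℚ_p} (⊕_w E′_w)` (`E′_w = L′_w` as finite-dimensional intermediate fields of an algebraic closure of `K`, i.e.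
"contained in `Q̄_p`") and `Θ̃_{Joshi,p} ⊂ B̆_p^{ℓ*}` (§7.5.3, Thm. 7.5.4.2; E-t13) as an abstract subset. The tensor power
is Mathlib's `PiTensorProduct` over `B` with its ring structure; the multiplication of (7.8.1.1) is
`MultilinearMap.mkPiAlgebra` lifted by `PiTensorProduct.liftAlgHom`, so the factorisation is PROVED. Norms (§7.6,
E-t14) enter only Rmk. 7.8.3.2 / the last sentence of Thm. 7.8.3.1, as bare real-valued functions.

DICTIONARY toward our interface (E3 rows; recorded, not adjudicated), on `Summit.ABC.IUTFork.Thm311.ThetaIndex`: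
`V^{odd,ss}_p = {w ∈ V^{odd,ss} : w | p}` (§3.4 p.29 l.1–9; (7.5.1.3) p.58 l.4–10; Joshi-side typing: E-t6's
`ATS3.InitialThetaData.VoddssP`) ↦ `badFibre T vQ` (Joshi takes ALL odd semistable places of `V ≃ V_{Lmod}`, [IUTchI]
Def. 3.1 (b) a nonempty subset — as printed); `ℓ*` ↦ `T.lstar`; `{p : V^{odd,ss}_p ≠ ∅}` (p.66 l.59) ↦ `activePlaces T`. Rmk. 7.8.1.4 compares with the packet
`Thm311.LogShells.Packet j vQ = ⨂[ℚ]_{i ∈ S^±_{j+1}} (⊕_{v|vQ} log(D⊢_v))` (Thm311Sig.lean): Joshi tensors `ℓ*` copies of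
`B̆_p` over `B_p` at once, print's packet at label `j` has `j+1` factors over `ℚ` — a recorded mismatch.

AS-PRINTED NOTES for the referee lanes (faithfulness, not defects). (1) The render cannot distinguish `B̆`
(7.5.1.5: `⊕_{w ∈ V_{L′,p}} B_{E′_w}`) from the double-breve ring (7.5.2.1: `B ⊗_{ℚ_p} (⊕_w E′_w)`, Lem. 7.5.2.3); the
proof of Lemma 7.8.1.2 uses the latter form, which is the one typed (`bundlingIso`). (2) (7.8.1.3) indexes
"`w | p, w ∈ V_{Lmod}`" with `E_w`, (7.5.2.1) "`w ∈ V^{odd,ss}_p`" with `E′_w = L′_w`: the carrier abstracts over `W`.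
(3) Thm. 7.8.3.1 displays no inequality: "lower bounds … given by Theorem 7.7.3.1" is the READING
`AdelicNormedBundlingDatum.HatHatLowerBound`. (4) Rmk. 7.8.3.2's reason "since `Θ̂̂` is the image of `Θ̂`" does
not alone give the inequality; `supInequality_of_norm_mul_le` isolates the input, and
`norm_image_eq_of_cross_norm` records that under the cross-norm property (Thm. 7.6.2.2) and multiplicativity of
`|·|_{B̆}` on lifts the two value sets COINCIDE (every element of `Θ̂` is a pure tensor).
Deliberately NOT here: `B_p`, `B̆_p`, `Θ̃_{Joshi,p}`, Thm. 7.7.3.1 themselves (E-t9, E-t13), tensor norms (E-t14),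
§7.9 (sequel file), any TEST against `Cor312.PilotKummerIndRelated` (§7.8 contains no q-pilot or Θ-pilot region and
no indeterminacy statement; plan/E/README.md §5), any judgement.
-/

noncomputable section

open scoped TensorProduct

namespace Summit.ABC.IUTFork.Joshi.ATS3
universe uK uB uA uW uJ uP uM uΩ

/-! ## 0. Dictionary anchors on the index skeleton of initial Θ-data -/

section Dictionary

open Summit.ABC.IUTFork.Thm311

/-- Joshi's `V^{odd,ss}_p = {w ∈ V^{odd,ss} : w | p}` ([J-III] §3.4, p.29 l.1–9; (7.5.1.3), p.58 l.4–10) read on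
our index skeleton `Thm311.ThetaIndex` as the set of bad places over the place `vQ` of `ℚ`:
`{v ∈ T.Vbad | T.over v = vQ}`. DICTIONARY (as printed: Joshi's `V^{odd,ss}` is the set of ALL odd semistable
places in `V ≃ V_{Lmod}`, [IUTchI] Def. 3.1 (b) lets `V^bad_mod` be a nonempty subset of them).
[claim: Joshi2024ATS3, status: disputed] -/
def badFibre (T : ThetaIndex) (vQ : T.VQ) : Set T.V :=
  {v | v ∈ T.Vbad ∧ T.over v = vQ}

/-- `V^{odd,ss}_p ⊆ V^{odd,ss}` is finite ([J-III] p.66 l.59; from `ThetaIndex.Vbad_finite`). PROVED. -/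
theorem badFibre_finite (T : ThetaIndex) (vQ : T.VQ) : (badFibre T vQ).Finite :=
  T.Vbad_finite.subset fun _ hv => hv.1

/-- The set of rational primes `p` (places `vQ` of `ℚ`) with `V^{odd,ss}_p ≠ ∅` — the index set of the products
`Π_{p, V^{odd,ss}_p ≠ ∅}` of (7.7.2.1)–(7.7.2.2) and of Thm. 7.8.3.1 ([J-III] p.66 l.36–59, p.69 l.19–44).
[claim: Joshi2024ATS3, status: disputed] -/
def activePlaces (T : ThetaIndex) : Set T.VQ :=
  {vQ | (badFibre T vQ).Nonempty}

/-- "Note that both the products are over a finite set of rational primes `p`" ([J-III] p.66 l.59):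
`{p : V^{odd,ss}_p ≠ ∅}` is the image of the finite set `V^{odd,ss}` under `v ↦ v_ℚ`. PROVED. -/
theorem activePlaces_finite (T : ThetaIndex) : (activePlaces T).Finite := by
  refine (T.Vbad_finite.image T.over).subset ?_
  rintro _ ⟨v, hv, rfl⟩
  exact ⟨v, hv, rfl⟩

/-- There is at least one rational prime with `V^{odd,ss}_p ≠ ∅` (from `ThetaIndex.Vbad_nonempty`). PROVED. -/
theorem activePlaces_nonempty (T : ThetaIndex) : (activePlaces T).Nonempty := by
  obtain ⟨v, hv⟩ := T.Vbad_nonempty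
  exact ⟨T.over v, v, hv, rfl⟩

/-- Every active place is nonarchimedean (from `ThetaIndex.Vbad_non`). PROVED. -/
theorem isNon_of_mem_activePlaces (T : ThetaIndex) {vQ : T.VQ} (h : vQ ∈ activePlaces T) : T.IsNon vQ := by
  obtain ⟨v, hv, rfl⟩ := h
  exact T.Vbad_non v hv

end Dictionary

/-! ## 1. The carrier of §7.8: the bundling ring `B̆_p` as a `B_p`-algebra with its presentation, and `Θ̃_{Joshi,p}` -/

/-- CARRIER of [J-III] §7.8 at one rational prime `p` (SIGNATURE; nothing asserted). Unbundled parameters: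
`K` = `ℚ_p`; `B` = `B_p = B_{ℂ_p^♭,ℚ_p}` (§5.2; E-t9); `A` = the bundling ring `B̆_p`, "treated as a finite
`B_p`-algebra" (p.67 l.69; Lemma 7.5.1.9 p.58 l.69–77; E-t13); `W` = `V^{odd,ss}_p` (7.5.1.3); `J` = the labels
`{1, …, ℓ*}` of `ℓ*`-tuples (Rmk. 7.5.1.7, p.58 l.63–65). Fields: the finite extensions `E′_w = L′_w` of `ℚ_p` "contained
in `Q̄_p`" (p.58 l.45–47, p.68 l.10–12) as finite-dimensional intermediate fields of an algebraic closure of `K`; the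
PRESENTATION `B̆_p ≅ B_p ⊗_{ℚ_p} (⊕_w E′_w)` ((7.5.2.1)/Lemma 7.5.2.3 p.59 l.17–57, quoted as (7.8.1.3) p.68 l.15–21) as a
`B_p`-algebra isomorphism; the locus `Θ̃_{Joshi,p} ⊂ B̆_p^{ℓ*}` ((7.5.3.1)/Thm. 7.5.4.2, p.59 l.58 – p.60 l.40) as an
abstract subset (E-t13's construction). Merge-debt «J3:§5 = E-t9; §7.5/§7.7 = E-t13». [claim: Joshi2024ATS3, status: disputed] -/
structure BundlingDatum (K : Type uK) (B : Type uB) (A : Type uA) [Field K] [CommRing B] [Algebra K B]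
    [CommRing A] [Algebra B A] (W : Type uW) (J : Type uJ) where
  /-- `V^{odd,ss}_p` is finite (p.66 l.59). -/
  finite_W : Finite W
  /-- the fields `E′_w = L′_w ⊂ Q̄_p`, `w ∈ V^{odd,ss}_p` (p.58 l.45–47). -/
  Eprime : W → IntermediateField K (AlgebraicClosure K)
  /-- each `E′_w / ℚ_p` is a finite extension. -/
  finiteDimensional_Eprime : ∀ w, FiniteDimensional K (Eprime w)
  /-- (7.5.2.1)/Lemma 7.5.2.3/(7.8.1.3): `B̆_p ≅ B_p ⊗_{ℚ_p} (⊕_{w ∈ V^{odd,ss}_p} E′_w)` as `B_p`-algebras. -/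
  bundlingIso : A ≃ₐ[B] (B ⊗[K] (∀ w, Eprime w))
  /-- `Θ̃_{Joshi,p} ⊂ B̆_p^{ℓ*}` ((7.5.3.1), Thm. 7.5.4.2; (7.8.2.2) p.68 l.42). -/
  thetaLocus : Set (J → A)

/-! ## 2. §7.8.1: multiplication of lifts of theta-values and the factorisation (7.8.1.1) -/

section Multiplication

variable (B : Type uB) (A : Type uA) [CommRing B] [CommRing A] [Algebra B A] (J : Type uJ)

/-- The `ℓ*`-fold tensor power `B̆_p ⊗_{B_p} B̆_p ⊗_{B_p} ⋯ ⊗_{B_p} B̆_p` of the `B_p`-algebra `B̆_p`, indexed by the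
labels `J = {1, …, ℓ*}` ([J-III] (7.8.1.1), p.67 l.68–76), as Mathlib's `PiTensorProduct` over `B` with its
commutative `B`-algebra structure. [claim: Joshi2024ATS3, status: disputed] -/
abbrev TensorPow := ⨂[B] _j : J, A

variable {A J}

/-- The first arrow of (7.8.1.1), `(b_1, …, b_{ℓ*}) ↦ b_1 ⊗ b_2 ⊗ ⋯ ⊗ b_{ℓ*}` (p.67 l.77).
[claim: Joshi2024ATS3, status: disputed] -/
def toTensor (b : J → A) : TensorPow B A J :=
  PiTensorProduct.tprod B b

variable {B} [Fintype J]

/-- The multiplication map `B̆_p^{ℓ*} → B̆_p`, `(b̆_1, …, b̆_{ℓ*}) ↦ b̆_1 · b̆_2 ⋯ b̆_{ℓ*}` ([J-III] §7.8.1,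
p.67 l.60–67). [claim: Joshi2024ATS3, status: disputed] -/
def mulMap (b : J → A) : A := ∏ j, b j

variable (B)

/-- "This is multi-linear in each coordinate" (p.67 l.68): the multiplication map as a `B_p`-multilinear map
(Mathlib's `MultilinearMap.mkPiAlgebra`). [claim: Joshi2024ATS3, status: disputed] -/
def mulMultilinear : MultilinearMap B (fun _ : J => A) A :=
  MultilinearMap.mkPiAlgebra B J A

/-- The multilinear map is the multiplication map. PROVED. -/
theorem mulMultilinear_apply (b : J → A) : mulMultilinear B b = mulMap b := MultilinearMap.mkPiAlgebra_apply b

variable (A J)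

/-- The second arrow of (7.8.1.1), "the natural mapping `b_1 ⊗ b_2 ⊗ ⋯ ⊗ b_{ℓ*} ↦ b_1 · b_2 ⋯ b_{ℓ*}`" (p.67 l.77–78):
the `B_p`-algebra homomorphism `B̆_p ⊗_{B_p} ⋯ ⊗_{B_p} B̆_p → B̆_p` through which the multilinear multiplication
"factors" (p.67 l.68–69), obtained from Mathlib's `PiTensorProduct.liftAlgHom`.
[claim: Joshi2024ATS3, status: disputed] -/
def mulFromTensor : TensorPow B A J →ₐ[B] A :=
  PiTensorProduct.liftAlgHom (MultilinearMap.mkPiAlgebra B J A)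
    (by simp only [MultilinearMap.mkPiAlgebra_apply, Pi.one_apply, Finset.prod_const_one])
    (fun x y => by simp only [MultilinearMap.mkPiAlgebra_apply, Pi.mul_apply, Finset.prod_mul_distrib])

variable {A J}

/-- **The factorisation (7.8.1.1)** ([J-III] p.67 l.68–78): multiplication = (second arrow) ∘ (first arrow).
PROVED from the signature (Mathlib `PiTensorProduct.lift.tprod`). -/
theorem mulFromTensor_toTensor (b : J → A) : mulFromTensor B A J (toTensor B b) = mulMap b := by
  simp only [mulFromTensor, toTensor, PiTensorProduct.liftAlgHom_apply, PiTensorProduct.lift.tprod,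
    MultilinearMap.mkPiAlgebra_apply, mulMap]

end Multiplication

/-! ## 3. §7.8.2: the loci `Θ̂_{Joshi,p}` and `Θ̂̂_{Joshi,p}`; Lemma 7.8.1.2 as a typed claim -/

namespace BundlingDatum

variable {K : Type uK} {B : Type uB} {A : Type uA} [Field K] [CommRing B] [Algebra K B] [CommRing A]
  [Algebra B A] {W : Type uW} {J : Type uJ} (D : BundlingDatum K B A W J)

/-- (7.8.2.1)–(7.8.2.2) ([J-III] p.68 l.32–46): `Θ̂_{Joshi,p} ⊂ B̆_p ⊗_{B_p} ⋯ ⊗_{B_p} B̆_p`, "the image of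
`Θ̃_{Joshi,p} ⊂ B̆_p^{ℓ*} → B̆_p ⊗_{B_p} ⋯ ⊗_{B_p} B̆_p` under the above mapping" — so every element of `Θ̂_{Joshi,p}` is
a pure tensor `b_1 ⊗ ⋯ ⊗ b_{ℓ*}` of a tuple of `Θ̃_{Joshi,p}`. [claim: Joshi2024ATS3, status: disputed] -/
def hatLocus : Set (TensorPow B A J) :=
  toTensor B '' D.thetaLocus

/-- The `B_p`-algebra `B_p ⊗_{ℚ_p} (⊕_{w ∈ V^{odd,ss}_p} E′_w)` PRESENTING `B̆_p` ((7.5.2.1), Lemma 7.5.2.3, (7.8.1.3)).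
[claim: Joshi2024ATS3, status: disputed] -/
abbrev Presented : Type (max uK uB uW) :=
  B ⊗[K] (∀ w, D.Eprime w)

/-- **Lemma 7.8.1.2 as a typed CLAIM** ([J-III] p.68 l.1–12): "One has the decomposition of the `B_p`-algebra:
`B̆_p ⊗_{B_p} B̆_p ⊗_{B_p} ⋯ ⊗_{B_p} B̆_p = B_p ⊗_{ℚ_p} (⊕_α E″_α)` where the sum on the right runs over a finite
multi-set of finite extensions `E″_α` of `ℚ_p` contained in `Q̄_p`." Printed proof (p.68 l.13–25): "immediate from
the definition of `B̆_p` and properties of tensor products. Indeed, since (7.8.1.3) `B̆_p = B_{ℂ_p^♭,ℚ_p} ⊗_{ℚ_p}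
(⊕_{w|p, w ∈ V_{Lmod}} E_w)` and as the tensor product `B̆_p ⊗_{B_p} B̆_p` reduces to computing tensor products of a
finite collection of p-adic fields". Typed for the PRESENTED ring of (7.8.1.3) (`Presented`), with the `E″_α`
intermediate fields of the same algebraic closure (transport to `A = B̆_p` along `bundlingIso` is standard); used
at (7.8.2.5) "`Θ̂_{Joshi,p} ⊂ B_p ⊗_{ℚ_p} (⊕_α E″_α)`" (p.69 l.1–8). Rmk. 7.8.1.4 (p.68 l.26–31): "Mochizuki forces the
tensor product structure and arrives essentially at the above lemma" ([IUTchIII] Rmk. 3.1.1, 3.9.1; [IUTchIV]) —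
E3 dictionary row toward `Thm311.LogShells.Packet` (module docstring), not adjudicated. HYPOTHESIS (asserted in
print; standard commutative algebra — a discharge candidate: base change of tensor powers and the structure of
tensor products of finite separable extensions); nothing is asserted here. [claim: Joshi2024ATS3, status: disputed] -/
@[claim "Joshi2024ATS3" "disputed"]
def TensorPowerDecomposition : Prop :=
  ∃ (α : Type) (E'' : α → IntermediateField K (AlgebraicClosure K)),
    Finite α ∧ (∀ a, FiniteDimensional K (E'' a)) ∧
      Nonempty (TensorPow B D.Presented J ≃ₐ[B] (B ⊗[K] (∀ a, E'' a)))

variable [Fintype J]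

/-- (7.8.2.3)–(7.8.2.4) ([J-III] p.68 l.47 – p.69 l.1): `Θ̂̂_{Joshi,p} ⊂ B̆_p`, "the image of
`Θ̃_{Joshi,p} ⊂ B̆_p^{ℓ*} → B̆_p` under the multiplication mapping". [claim: Joshi2024ATS3, status: disputed] -/
def hatHatLocus : Set A :=
  mulMap '' D.thetaLocus

/-- "`Θ̂̂_{Joshi,p}` is the image of `Θ̂_{Joshi,p}` under the vertical arrow in the above diagram" ([J-III] p.69
l.9–10). PROVED from the factorisation (7.8.1.1). -/
theorem hatHatLocus_eq_image_hatLocus : D.hatHatLocus = mulFromTensor B A J '' D.hatLocus := by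
  rw [hatHatLocus, hatLocus, Set.image_image]
  exact Set.image_congr fun b _ => (mulFromTensor_toTensor B b).symm

end BundlingDatum

/-! ## 4. Remark 7.8.3.2: the norms `|·|_{B̆}` and the two suprema (at one prime) -/

/-- CARRIER of Rmk. 7.8.3.2 ([J-III] p.69 l.60 – p.70 l.10): a §7.8 carrier with "a collection of norms given using
`B` on `B̆`" — two bare real-valued functions, `normA = |·|_{B̆}` on `B̆_p` and `normT` on the tensor power
`B̆_p ⊗_{B_p} ⋯ ⊗_{B_p} B̆_p` (the tensor norms of §7.6; merge-debt «J3:§7.6 = E-t14»). No normed-space structure is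
assumed. SIGNATURE; nothing asserted. [claim: Joshi2024ATS3, status: disputed] -/
structure NormedBundlingDatum (K : Type uK) (B : Type uB) (A : Type uA) [Field K] [CommRing B] [Algebra K B]
    [CommRing A] [Algebra B A] (W : Type uW) (J : Type uJ) extends BundlingDatum K B A W J where
  /-- `|·|_{B̆}` on `B̆_p` (p.69 l.61). -/
  normA : A → ℝ
  /-- the norm on `B̆_p ⊗_{B_p} ⋯ ⊗_{B_p} B̆_p` (§7.6). -/
  normT : TensorPow B A J → ℝ

namespace NormedBundlingDatum

variable {K : Type uK} {B : Type uB} {A : Type uA} [Field K] [CommRing B] [Algebra K B] [CommRing A]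
  [Algebra B A] {W : Type uW} {J : Type uJ} (D : NormedBundlingDatum K B A W J)

/-- `sup{|z|_{B̆} : z ∈ Θ̂_{Joshi,p}}` ([J-III] p.69 l.63–68), as a conditional supremum of reals (Mathlib's junk
value for an empty or unbounded set). [claim: Joshi2024ATS3, status: disputed] -/
def supHat : ℝ :=
  sSup (D.normT '' D.hatLocus)

variable [Fintype J]

/-- `sup{|z|_{B̆} : z ∈ Θ̂̂_{Joshi,p}}` ([J-III] p.69 l.69–77). [claim: Joshi2024ATS3, status: disputed] -/
def supHatHat : ℝ :=
  sSup (D.normA '' D.hatHatLocus)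

/-- **Rmk. 7.8.3.2, the displayed inequality** ([J-III] p.69 l.78–96): "since `Θ̂̂^{B̆}_Joshi` is the image
`Θ̂^{B̆}_Joshi` so one has `sup{|z|_{B̆} : z ∈ Θ̂^{B̆}_Joshi} ≥ sup{|z|_{B̆} : z ∈ Θ̂̂^{B̆}_Joshi}`" (printed for the
adelic loci; typed at one prime). HYPOTHESIS; the printed reason (being an image) does not alone yield it — see
`supInequality_of_norm_mul_le` for inputs that do. Nothing is asserted here. [claim: Joshi2024ATS3, status: disputed] -/
@[claim "Joshi2024ATS3" "disputed"]
def SupInequality : Prop :=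
  D.supHatHat ≤ D.supHat

/-- Rmk. 7.8.3.2's inequality DERIVED from explicit inputs: if (a) the multiplication arrow
`B̆_p ⊗_{B_p} ⋯ ⊗_{B_p} B̆_p → B̆_p` does not increase norm on `Θ̂_{Joshi,p}` (e.g. from submultiplicativity of
`|·|_{B̆}` and the cross-norm property `|v ⊗ w| = |v|·|w|`, §7.6), (b) `Θ̂_{Joshi,p}` is norm-bounded, and (c)
`Θ̃_{Joshi,p}` is nonempty, then `sup Θ̂̂ ≤ sup Θ̂`. PROVED (Mathlib `csSup_le`, `le_csSup`). -/
theorem supInequality_of_norm_mul_le (hne : D.thetaLocus.Nonempty) (hbdd : BddAbove (D.normT '' D.hatLocus))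
    (hle : ∀ t ∈ D.hatLocus, D.normA (mulFromTensor B A J t) ≤ D.normT t) : D.SupInequality := by
  have hne' : (D.normA '' D.hatHatLocus).Nonempty := (hne.image _).image _
  refine csSup_le hne' ?_
  rintro _ ⟨a, ha, rfl⟩
  rw [D.hatHatLocus_eq_image_hatLocus] at ha
  obtain ⟨t, ht, rfl⟩ := ha
  exact (hle t ht).trans (le_csSup hbdd (Set.mem_image_of_mem _ ht))

/-- Rmk. 7.8.3.2, continued ([J-III] p.69 l.97 – p.70 l.5): "since `|v ⊗ w|_{V ⊗ W} = |v|_V·|w|_W` an element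
`z ∈ Θ̂^{B̆}_Joshi` also provides a lower bound on the supremum for `Θ̂̂^{B̆}_Joshi`." DERIVED form: if the tensor
norm is a cross-norm on the pure tensors of the locus (Thm. 7.6.2.2) AND `|·|_{B̆}` is multiplicative on the
tuples of the locus, then the value sets `{|z| : z ∈ Θ̂}` and `{|z| : z ∈ Θ̂̂}` COINCIDE (every element of
`Θ̂_{Joshi,p}` is a pure tensor), so the two suprema are equal. PROVED; recorded next to the author's heuristic
"the passage to `Θ̂̂` should be expected to provide tighter upper bounds!" (p.70 l.6–10), without adjudication. -/
theorem norm_image_eq_of_cross_norm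
    (hcross : ∀ b ∈ D.thetaLocus, D.normT (toTensor B b) = ∏ j, D.normA (b j))
    (hmul : ∀ b ∈ D.thetaLocus, D.normA (mulMap b) = ∏ j, D.normA (b j)) :
    D.normT '' D.hatLocus = D.normA '' D.hatHatLocus := by
  ext r
  simp only [BundlingDatum.hatLocus, BundlingDatum.hatHatLocus, Set.image_image, Set.mem_image]
  constructor
  · rintro ⟨b, hb, rfl⟩
    exact ⟨b, hb, by rw [hmul b hb, hcross b hb]⟩
  · rintro ⟨b, hb, rfl⟩
    exact ⟨b, hb, by rw [hmul b hb, hcross b hb]⟩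

/-- Under the inputs of `norm_image_eq_of_cross_norm` the two suprema of Rmk. 7.8.3.2 are EQUAL. PROVED. -/
theorem supHat_eq_supHatHat_of_cross_norm
    (hcross : ∀ b ∈ D.thetaLocus, D.normT (toTensor B b) = ∏ j, D.normA (b j))
    (hmul : ∀ b ∈ D.thetaLocus, D.normA (mulMap b) = ∏ j, D.normA (b j)) :
    D.supHat = D.supHatHat := by
  rw [supHat, supHatHat, D.norm_image_eq_of_cross_norm hcross hmul]

end NormedBundlingDatum

/-! ## 5. §7.8.3, Theorem 7.8.3.1: the adelic loci `Θ̂^{B̆}_Joshi`, `Θ̂̂^{B̆}_Joshi` and "lower bounds … by Thm. 7.7.3.1" -/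

/-- CARRIER of [J-III] §7.8.3 (SIGNATURE; nothing asserted): a family of normed §7.8 carriers indexed by the
finite set `P` of rational primes `p` with `V^{odd,ss}_p ≠ ∅` (p.66 l.59; our `activePlaces T`) — per-prime unbundled
carriers `K p = ℚ_p`, `B p = B_p`, `A p = B̆_p`, `W p = V^{odd,ss}_p`, one label set `J = {1, …, ℓ*}` — together with
the adelic norm `|·|_{B̆}` on `Π_p B̆_p` (Rmk. 7.8.3.2, p.69 l.61) and the real constant `thetaBound =
Π_{w ∈ V^{odd,ss}} |q_w^{1/2ℓ}|^{ℓ*}_{ℂ_{p_w}}` of Thm. 7.7.3.1 (p.66 l.62–94, normalisation `|π_w|_{ℂ_{p_w}} = p_w^{-1}`;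
E-t13's theorem, E-t11's Tate parameters — merge-debt). [claim: Joshi2024ATS3, status: disputed] -/
structure AdelicBundlingDatum (P : Type uP) (K : P → Type uK) (B : P → Type uB) (A : P → Type uA)
    [∀ p, Field (K p)] [∀ p, CommRing (B p)] [∀ p, Algebra (K p) (B p)] [∀ p, CommRing (A p)]
    [∀ p, Algebra (B p) (A p)] (W : P → Type uW) (J : Type uJ) where
  /-- the set of rational primes with `V^{odd,ss}_p ≠ ∅` is finite (p.66 l.59). -/
  finite_P : Finite P
  /-- the normed §7.8 carrier at each such prime. -/
  loc : ∀ p, NormedBundlingDatum (K p) (B p) (A p) (W p) J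
  /-- the adelic norm `|·|_{B̆}` on `Π_p B̆_p`. -/
  adelicNorm : (∀ p, A p) → ℝ
  /-- the right-hand side `Π_{w ∈ V^{odd,ss}} |q_w^{1/2ℓ}|^{ℓ*}_{ℂ_{p_w}}` of Thm. 7.7.3.1 (p.66 l.84–94). -/
  thetaBound : ℝ

namespace AdelicBundlingDatum

variable {P : Type uP} {K : P → Type uK} {B : P → Type uB} {A : P → Type uA} [∀ p, Field (K p)]
  [∀ p, CommRing (B p)] [∀ p, Algebra (K p) (B p)] [∀ p, CommRing (A p)] [∀ p, Algebra (B p) (A p)]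
  {W : P → Type uW} {J : Type uJ} (D : AdelicBundlingDatum P K B A W J)

/-- **Theorem 7.8.3.1, first display** ([J-III] p.69 l.15–33): "The adelic theta-values locus for the ring `B̆_p`
(for each prime `p`), is denoted by `Θ̂^{B̆}_Joshi` and is the naturally defined locus constructed above:
`Θ̂^{B̆}_Joshi = Π_p Θ̂_{Joshi,p} ⊂ Π_p (B̆_p ⊗_{B_p} B̆_p ⊗_{B_p} ⋯ ⊗_{B_p} B̆_p)`". DEFINITION (the product set).
[claim: Joshi2024ATS3, status: disputed] -/
def hatLocus : Set (∀ p, TensorPow (B p) (A p) J) :=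
  Set.univ.pi fun p => (D.loc p).hatLocus

/-- **Theorem 7.8.3.1, the decomposition** ([J-III] p.69 l.26–47): "`⊂ Π_p (B̆_p ⊗_{B_p} ⋯ ⊗_{B_p} B̆_p) =
Π_p (B_p ⊗_{ℚ_p} (⊕_α E″_{p,α}))`, where the finite collections of fields `E″_{p,α}` appearing on the extreme right
is the collection of fields appearing in Lemma 7.8.1.2." Typed CLAIM = Lemma 7.8.1.2 at every active prime.
HYPOTHESIS; nothing is asserted here. [claim: Joshi2024ATS3, status: disputed] -/
@[claim "Joshi2024ATS3" "disputed"]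
def Decomposition : Prop :=
  ∀ p, (D.loc p).TensorPowerDecomposition

variable [Fintype J]

/-- **Theorem 7.8.3.1, second display** ([J-III] p.69 l.48–57): "Similarly, one has an adelic theta-values locus
`Θ̂̂_Joshi` using the ring `B̆_p`: `Θ̂̂^{B̆}_Joshi ⊂ Π_p B̆_p`." DEFINITION. [claim: Joshi2024ATS3, status: disputed] -/
def hatHatLocus : Set (∀ p, A p) :=
  Set.univ.pi fun p => (D.loc p).hatHatLocus

/-- `Θ̂̂^{B̆}_Joshi` is the image of `Θ̂^{B̆}_Joshi` under the product of the multiplication arrows (the adelic form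
of p.69 l.9–10). PROVED. -/
theorem hatHatLocus_eq_image_hatLocus :
    D.hatHatLocus = (fun t p => mulFromTensor (B p) (A p) J (t p)) '' D.hatLocus := by
  ext a
  simp only [hatHatLocus, hatLocus, Set.mem_univ_pi, Set.mem_image, BundlingDatum.hatHatLocus_eq_image_hatLocus]
  constructor
  · intro h
    choose t ht hta using h
    exact ⟨t, ht, funext hta⟩
  · rintro ⟨t, ht, rfl⟩ p
    exact ⟨t p, ht p, rfl⟩

/-- **Thm. 7.8.3.1, last sentence, as a typed READING** ([J-III] p.69 l.58–59: "One also has lower bounds on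
these locii given by Theorem 7.7.3.1"; no inequality is displayed): `sup{|z|_{B̆} : z ∈ Θ̂̂^{B̆}_Joshi} ≥
Π_{w ∈ V^{odd,ss}} |q_w^{1/2ℓ}|^{ℓ*}_{ℂ_{p_w}}` — the shape of Thm. 7.7.3.1 (p.66 l.72–94) transferred to the
multiplicative locus. READING (flagged for the referee lanes); HYPOTHESIS; nothing is asserted here.
[claim: Joshi2024ATS3, status: disputed] -/
@[claim "Joshi2024ATS3" "disputed"]
def HatHatLowerBound : Prop :=
  D.thetaBound ≤ sSup (D.adelicNorm '' D.hatHatLocus)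

/-- A single witness suffices for the READING `HatHatLowerBound`: an element of `Θ̂̂^{B̆}_Joshi` of adelic norm
`≥ thetaBound` plus norm-boundedness of `Θ̂̂^{B̆}_Joshi` give the lower bound on the supremum — the shape of the
printed proof of Thm. 7.7.3.1 (p.66 l.104–120: "contains a pure tensor `⊗_{w|p} Z_w` such that …"). PROVED
(Mathlib `le_csSup_of_le`). -/
theorem hatHatLowerBound_of_witness {a : ∀ p, A p} (ha : a ∈ D.hatHatLocus) (hbound : D.thetaBound ≤ D.adelicNorm a)
    (hbdd : BddAbove (D.adelicNorm '' D.hatHatLocus)) : D.HatHatLowerBound :=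
  le_csSup_of_le hbdd (Set.mem_image_of_mem _ ha) hbound

end AdelicBundlingDatum

end Summit.ABC.IUTFork.Joshi.ATS3
end
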